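import Mathlib
import Summits.NavierStokesRegularity.NavierStokesRegularity.Theorems.WakeRatchetTailRatchet.Negative.TailRatchetFalseOfDyadicScalarFronts
import HarnessLib

/-!
# `WakeRatchet.TailRatchet` (stmt-NavierStokesRegularity-21808): the ADJOINT MODE of the linearised
# drain-free front equation at the relay profile — an explicit lacunary exponential series

Support file for the crux `TailRatchet` (route `WakeRatchet`; MODEL lattice ODEs of Tao 2016 §1.2, §4 —
nothing in this file is a statement about the Navier–Stokes equations, and no item is closed here).

Context (companion file `WakeRatchetTailRatchetRelayProfile`, census of stmt-21808, programme "R-lac"):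
the construction item `WakeRatchetDyadicFront.DyadicScalarFronts` (modulo which the crux is refuted) asks
for fronts `a' = (Λ/s²)a(t/s)² − (s/Λ)a(t)a(st)` on `t < 0`.  With `a = (4/Λ) b`, `δ = Λ⁻²` this is
`G_δ(b,s) = b' − (4/s²) b(t/s)² + 4sδ·b(t)b(st) = 0`, and at `δ = 0` the relay profile `(b₀,s₀) = (e^t, 2)`
is an exact solution.  The linearisation `L₀ h = h' − 2e^{t/2} h(t/2)` has the one-dimensional kernel
spanned by the scaling mode `(1+t)e^t`; an implicit-function / continuation construction in `δ` needs
the bordered operator `(h, σ) ↦ L₀ h + σ ∂_sG` to be onto, i.e. the CO-KERNEL of `L₀` — spanned by a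
solution `w` of the ADJOINT pantograph equation
`w'(t) = −4 e^{t} w(2t)`  (`t < 0`),  `w(−∞) = 1`
(integration by parts: `∫_{−∞}^0 w · L₀h = w(0)h(0) − w(−∞)h(−∞) − ∫ (w' + 4e^{t}w(2t)) h`) — not to
annihilate `∂_sG(b₀,2) = (1 + t/2)e^{t}`.  This file constructs that adjoint mode EXPLICITLY:

`w₁(t) = Σ_{m ≥ 0} c_m e^{(2^m − 1)t}`, `c_m = ∏_{i<m} (−4)/(2^{i+1} − 1)`
(`c = 1, −4, 16/3, −64/21, 256/315, …`; `c_{m+1}(2^{m+1} − 1) = −4 c_m`), and proves, sorry-free: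

* `coeff_abs_le` — `|c_m| ≤ 210 · 4^{−m}` (so the series and its termwise derivative converge
  absolutely and locally uniformly on `t ≤ 0`, `adjoint_summable`, `adjoint_deriv_summable`);
* `adjoint_hasDerivAt` — **`w₁' (t) = −4 e^{t} w₁(2t)` for every `t < 0`** (termwise differentiation,
  `hasDerivAt_tsum_of_isPreconnected`, and the index shift `m ↦ m+1`);
* `adjoint_sub_one_abs_le` — **`|w₁(t) − 1| ≤ 70 e^{t}` for `t ≤ 0`**, in particular `w₁ → 1` at `−∞`
  (`adjoint_tendsto_atBot`), so `w₁` is the (unique up to scale, bounded-at-`−∞`) adjoint mode.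

RECORDED, NOT CLAIMED HERE (paper computation): `w₁(0) = Σ_m c_m = ∏_{i≥1}(1 − 4·2^{−i}) = 0` (Euler's
`q`-exponential identity at `q = ½`; consistent with the normalisation `h(0) = 0` killing the kernel), and
the transversality number `∫_{−∞}^0 w₁(t)(1 + t/2)e^{t} dt = Σ_m c_m (2^{−m} − 2^{−2m−1})
= −½ ∏_{i≥1}(1 − 2^{−i}) ≈ −0.1444 ≠ 0`.  Fronts for lacunary `Λ` do NOT refute `TailRatchet` (which needs
`Λ → 1`); they are the far end of a continuation in `Λ`.

HONEST FRAMING: elementary real analysis of an explicit series; MODEL lattice only; the construction item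
and the crux stay open.
-/

noncomputable section

set_option linter.dupNamespace false

namespace Summit.NavierStokesRegularity.NavierStokesRegularity.Theorems

namespace WakeRatchetRelayAdjoint

open MeasureTheory Set Filter Topology Real

/-! ## The coefficients `c_m = ∏_{i<m} (−4)/(2^{i+1} − 1)` -/

/-- The recursion `c_{m+1} = c_m · (−4)/(2^{m+1} − 1)`. [folklore] -/
theorem coeff_succ (m : ℕ) :
    (∏ i ∈ Finset.range (m + 1), ((-4 : ℝ) / (2 ^ (i + 1) - 1))) =
      (∏ i ∈ Finset.range m, ((-4 : ℝ) / (2 ^ (i + 1) - 1))) * ((-4 : ℝ) / (2 ^ (m + 1) - 1)) :=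
  Finset.prod_range_succ _ m

/-- The recursion in cleared form: `c_{m+1} · (2^{m+1} − 1) = −4 c_m`. [folklore] -/
theorem coeff_succ_mul (m : ℕ) :
    (∏ i ∈ Finset.range (m + 1), ((-4 : ℝ) / (2 ^ (i + 1) - 1))) * (2 ^ (m + 1) - 1) =
      -4 * ∏ i ∈ Finset.range m, ((-4 : ℝ) / (2 ^ (i + 1) - 1)) := by
  rw [coeff_succ, mul_assoc, div_mul_cancel₀ _ (sub_pos.2 (one_lt_pow₀ (by norm_num : (1 : ℝ) < 2) (by omega : m + 1 ≠ 0))).ne']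
  ring

/-- `|c_{m+1}| = |c_m| · 4/(2^{m+1} − 1)`. [folklore] -/
theorem coeff_abs_succ (m : ℕ) :
    |∏ i ∈ Finset.range (m + 1), ((-4 : ℝ) / (2 ^ (i + 1) - 1))| =
      |∏ i ∈ Finset.range m, ((-4 : ℝ) / (2 ^ (i + 1) - 1))| * (4 / (2 ^ (m + 1) - 1)) := by
  rw [coeff_succ, abs_mul, abs_div, abs_of_pos (sub_pos.2 (one_lt_pow₀ (by norm_num : (1 : ℝ) < 2) (by omega : m + 1 ≠ 0)))]
  norm_num

/-- `|c_m| ≤ 210 · 4^{−m}` for `m ≥ 4` (the ratio `4/(2^{m+1} − 1)` is `≤ 1/4` from `m = 4` on).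
[folklore] -/
theorem coeff_abs_le_of_four_le (m : ℕ) (hm : 4 ≤ m) :
    |∏ i ∈ Finset.range m, ((-4 : ℝ) / (2 ^ (i + 1) - 1))| ≤ 210 / 4 ^ m := by
  induction m, hm using Nat.le_induction with
  | base =>
    simp only [Finset.prod_range_succ, Finset.prod_range_zero]
    norm_num [abs_div, abs_of_pos]
  | succ n hn ih =>
    rw [coeff_abs_succ]
    have hpow : (32 : ℝ) ≤ 2 ^ (n + 1) := by
      calc (32 : ℝ) = 2 ^ 5 := by norm_num
        _ ≤ 2 ^ (n + 1) := pow_le_pow_right₀ (by norm_num) (by omega)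
    have hratio : 4 / ((2 : ℝ) ^ (n + 1) - 1) ≤ 1 / 4 := by
      rw [div_le_div_iff₀ (by linarith) (by norm_num)]
      linarith
    have h0 : 0 ≤ |∏ i ∈ Finset.range n, ((-4 : ℝ) / (2 ^ (i + 1) - 1))| := abs_nonneg _
    have h1 : 0 ≤ 4 / ((2 : ℝ) ^ (n + 1) - 1) := (div_pos (by norm_num) (sub_pos.2 (one_lt_pow₀ (by norm_num : (1 : ℝ) < 2) (by omega : n + 1 ≠ 0)))).le
    calc |∏ i ∈ Finset.range n, ((-4 : ℝ) / (2 ^ (i + 1) - 1))| * (4 / (2 ^ (n + 1) - 1))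
        ≤ 210 / 4 ^ n * (1 / 4) := mul_le_mul ih hratio h1 (by positivity)
      _ = 210 / 4 ^ (n + 1) := by rw [pow_succ]; ring

/-- **`|c_m| ≤ 210 · 4^{−m}` for every `m`.** [folklore] -/
theorem coeff_abs_le (m : ℕ) :
    |∏ i ∈ Finset.range m, ((-4 : ℝ) / (2 ^ (i + 1) - 1))| ≤ 210 / 4 ^ m := by
  rcases Nat.lt_or_ge m 4 with hm | hm
  · interval_cases m <;> simp only [Finset.prod_range_succ, Finset.prod_range_zero] <;>
      norm_num [abs_div, abs_of_pos]
  · exact coeff_abs_le_of_four_le m hm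

/-! ## The series `w₁(t) = Σ_m c_m e^{(2^m−1)t}`: absolute convergence on `t ≤ 0` -/

/-- On `t ≤ 0` the exponentials are at most `1`. [folklore] -/
theorem exp_term_le_one (m : ℕ) {t : ℝ} (ht : t ≤ 0) : Real.exp ((2 ^ m - 1) * t) ≤ 1 :=
  Real.exp_le_one_iff.2 (mul_nonpos_of_nonneg_of_nonpos (sub_nonneg.2 (one_le_pow₀ (by norm_num : (1 : ℝ) ≤ 2) : (1 : ℝ) ≤ 2 ^ m)) ht)

/-- The geometric majorant `210 · 4^{−m}` is summable. [folklore] -/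
theorem summable_majorant : Summable (fun m : ℕ => (210 : ℝ) / 4 ^ m) := by
  have h : Summable (fun m : ℕ => (210 : ℝ) * (1 / 4) ^ m) :=
    (summable_geometric_of_lt_one (by norm_num) (by norm_num)).mul_left 210
  refine h.congr fun m => ?_
  rw [one_div, inv_pow, div_eq_mul_inv]

/-- The geometric majorant `210 · 2^{−m}` (for the termwise derivatives) is summable. [folklore] -/
theorem summable_majorant_deriv : Summable (fun m : ℕ => (210 : ℝ) / 2 ^ m) := by
  have h : Summable (fun m : ℕ => (210 : ℝ) * (1 / 2) ^ m) :=
    (summable_geometric_of_lt_one (by norm_num) (by norm_num)).mul_left 210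
  refine h.congr fun m => ?_
  rw [one_div, inv_pow, div_eq_mul_inv]

/-- Termwise bound `|c_m e^{(2^m−1)t}| ≤ 210 · 4^{−m}` on `t ≤ 0`. [folklore] -/
theorem term_abs_le (m : ℕ) {t : ℝ} (ht : t ≤ 0) :
    ‖(∏ i ∈ Finset.range m, ((-4 : ℝ) / (2 ^ (i + 1) - 1))) * Real.exp ((2 ^ m - 1) * t)‖ ≤
      210 / 4 ^ m := by
  rw [Real.norm_eq_abs, abs_mul, abs_of_pos (Real.exp_pos _)]
  calc |∏ i ∈ Finset.range m, ((-4 : ℝ) / (2 ^ (i + 1) - 1))| * Real.exp ((2 ^ m - 1) * t)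
      ≤ 210 / 4 ^ m * 1 := mul_le_mul (coeff_abs_le m) (exp_term_le_one m ht) (Real.exp_pos _).le
          (by positivity)
    _ = 210 / 4 ^ m := mul_one _

/-- **The adjoint series converges absolutely on `t ≤ 0`.** [folklore] -/
theorem adjoint_summable {t : ℝ} (ht : t ≤ 0) :
    Summable (fun m : ℕ =>
      (∏ i ∈ Finset.range m, ((-4 : ℝ) / (2 ^ (i + 1) - 1))) * Real.exp ((2 ^ m - 1) * t)) :=
  Summable.of_norm_bounded summable_majorant fun m => term_abs_le m ht

/-- Termwise bound for the derivatives `|c_m (2^m−1) e^{(2^m−1)t}| ≤ 210 · 2^{−m}` on `t ≤ 0`.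
[folklore] -/
theorem deriv_term_abs_le (m : ℕ) {t : ℝ} (ht : t ≤ 0) :
    ‖(∏ i ∈ Finset.range m, ((-4 : ℝ) / (2 ^ (i + 1) - 1))) * ((2 ^ m - 1) *
        Real.exp ((2 ^ m - 1) * t))‖ ≤ 210 / 2 ^ m := by
  rw [Real.norm_eq_abs, abs_mul, abs_mul, abs_of_nonneg (sub_nonneg.2 (one_le_pow₀ (by norm_num : (1 : ℝ) ≤ 2) : (1 : ℝ) ≤ 2 ^ m)),
    abs_of_pos (Real.exp_pos _)]
  have h1 : (2 : ℝ) ^ m - 1 ≤ 2 ^ m := by linarith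
  have h4 : (4 : ℝ) ^ m = 2 ^ m * 2 ^ m := by
    rw [← mul_pow]; norm_num
  have hnn : 0 ≤ (2 ^ m - 1) * Real.exp ((2 ^ m - 1) * t) :=
    mul_nonneg (sub_nonneg.2 (one_le_pow₀ (by norm_num : (1 : ℝ) ≤ 2) : (1 : ℝ) ≤ 2 ^ m)) (Real.exp_pos _).le
  calc |∏ i ∈ Finset.range m, ((-4 : ℝ) / (2 ^ (i + 1) - 1))| * ((2 ^ m - 1) * Real.exp ((2 ^ m - 1) * t))
      ≤ 210 / 4 ^ m * (2 ^ m * 1) :=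
        mul_le_mul (coeff_abs_le m) (mul_le_mul h1 (exp_term_le_one m ht) (Real.exp_pos _).le
          (by positivity)) hnn (by positivity)
    _ = 210 / 2 ^ m := by rw [h4]; field_simp

/-- The termwise-differentiated series converges absolutely on `t ≤ 0`. [folklore] -/
theorem adjoint_deriv_summable {t : ℝ} (ht : t ≤ 0) :
    Summable (fun m : ℕ =>
      (∏ i ∈ Finset.range m, ((-4 : ℝ) / (2 ^ (i + 1) - 1))) * ((2 ^ m - 1) *
        Real.exp ((2 ^ m - 1) * t))) :=
  Summable.of_norm_bounded summable_majorant_deriv fun m => deriv_term_abs_le m ht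

/-! ## Termwise differentiation on the open half-line `t < 0` -/

/-- Derivative of one term. [folklore] -/
theorem term_hasDerivAt (m : ℕ) (t : ℝ) :
    HasDerivAt (fun t : ℝ =>
      (∏ i ∈ Finset.range m, ((-4 : ℝ) / (2 ^ (i + 1) - 1))) * Real.exp ((2 ^ m - 1) * t))
      ((∏ i ∈ Finset.range m, ((-4 : ℝ) / (2 ^ (i + 1) - 1))) * ((2 ^ m - 1) *
        Real.exp ((2 ^ m - 1) * t))) t := by
  have h1 : HasDerivAt (fun t : ℝ => (2 ^ m - 1) * t) ((2 ^ m - 1) * 1) t :=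
    (hasDerivAt_id' t).const_mul _
  have h2 := h1.exp.const_mul (∏ i ∈ Finset.range m, ((-4 : ℝ) / (2 ^ (i + 1) - 1)))
  refine h2.congr_deriv ?_
  ring

/-- **The adjoint series is differentiable on `t < 0` with the termwise derivative.** [folklore] -/
theorem adjoint_hasDerivAt_tsum {t : ℝ} (ht : t < 0) :
    HasDerivAt (fun t : ℝ => ∑' m : ℕ,
      (∏ i ∈ Finset.range m, ((-4 : ℝ) / (2 ^ (i + 1) - 1))) * Real.exp ((2 ^ m - 1) * t))
      (∑' m : ℕ, (∏ i ∈ Finset.range m, ((-4 : ℝ) / (2 ^ (i + 1) - 1))) * ((2 ^ m - 1) *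
        Real.exp ((2 ^ m - 1) * t))) t := by
  refine hasDerivAt_tsum_of_isPreconnected summable_majorant_deriv isOpen_Iio isPreconnected_Iio
    (fun m y _ => term_hasDerivAt m y) (fun m y hy => deriv_term_abs_le m (le_of_lt hy))
    (show (-1 : ℝ) ∈ Iio 0 by norm_num) (adjoint_summable (by norm_num)) ht

/-! ## The adjoint pantograph equation `w₁' = −4 e^{t} w₁(2t)` -/

/-- The index shift: `c_{m+1} (2^{m+1}−1) e^{(2^{m+1}−1)t} = −4 e^{t} · c_m e^{(2^m−1)(2t)}`.
[folklore] -/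
theorem deriv_term_succ (m : ℕ) (t : ℝ) :
    (∏ i ∈ Finset.range (m + 1), ((-4 : ℝ) / (2 ^ (i + 1) - 1))) * ((2 ^ (m + 1) - 1) *
        Real.exp ((2 ^ (m + 1) - 1) * t)) =
      -4 * Real.exp t * ((∏ i ∈ Finset.range m, ((-4 : ℝ) / (2 ^ (i + 1) - 1))) *
        Real.exp ((2 ^ m - 1) * (2 * t))) := by
  have hexp : Real.exp ((2 ^ (m + 1) - 1) * t) = Real.exp t * Real.exp ((2 ^ m - 1) * (2 * t)) := by
    rw [← Real.exp_add, pow_succ]; ring_nf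
  rw [hexp, ← mul_assoc, coeff_succ_mul]
  ring

/-- **The series identity behind the adjoint equation** (valid for all `t ≤ 0`):
`Σ_m c_m (2^m−1) e^{(2^m−1)t} = −4 e^{t} Σ_m c_m e^{(2^m−1)·2t}`. [folklore] -/
theorem adjoint_deriv_tsum_eq {t : ℝ} (ht : t ≤ 0) :
    (∑' m : ℕ, (∏ i ∈ Finset.range m, ((-4 : ℝ) / (2 ^ (i + 1) - 1))) * ((2 ^ m - 1) *
        Real.exp ((2 ^ m - 1) * t))) =
      -4 * Real.exp t * ∑' m : ℕ,
        (∏ i ∈ Finset.range m, ((-4 : ℝ) / (2 ^ (i + 1) - 1))) * Real.exp ((2 ^ m - 1) * (2 * t)) := by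
  rw [(adjoint_deriv_summable ht).tsum_eq_zero_add]
  have h0 : (∏ i ∈ Finset.range 0, ((-4 : ℝ) / (2 ^ (i + 1) - 1))) * ((2 ^ 0 - 1) *
      Real.exp ((2 ^ 0 - 1) * t)) = 0 := by simp
  rw [h0, zero_add, ← tsum_mul_left]
  exact tsum_congr fun m => deriv_term_succ m t

/-- **THE ADJOINT MODE.**  The explicit lacunary series `w₁(t) = Σ_m c_m e^{(2^m−1)t}` solves the adjoint
pantograph equation of the linearised drain-free front problem at the relay profile,
`w₁'(t) = −4 e^{t} w₁(2t)`, at every `t < 0`.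
[cite: Tao2016AveragedNS, §1.2 (dyadic model); cell vocabulary (linearisation of the scalar front equation of `DyadicScalarFronts` at the relay profile, drain dropped)] -/
theorem adjoint_hasDerivAt {t : ℝ} (ht : t < 0) :
    HasDerivAt (fun t : ℝ => ∑' m : ℕ,
      (∏ i ∈ Finset.range m, ((-4 : ℝ) / (2 ^ (i + 1) - 1))) * Real.exp ((2 ^ m - 1) * t))
      (-4 * Real.exp t * ∑' m : ℕ,
        (∏ i ∈ Finset.range m, ((-4 : ℝ) / (2 ^ (i + 1) - 1))) * Real.exp ((2 ^ m - 1) * (2 * t))) t := by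
  rw [← adjoint_deriv_tsum_eq ht.le]
  exact adjoint_hasDerivAt_tsum ht

/-! ## Normalisation at `−∞`: `w₁(t) = 1 + O(e^{t})` -/

/-- The `m = 0` term is the constant `1`. [folklore] -/
theorem term_zero (t : ℝ) :
    (∏ i ∈ Finset.range 0, ((-4 : ℝ) / (2 ^ (i + 1) - 1))) * Real.exp ((2 ^ 0 - 1) * t) = 1 := by
  simp

/-- Shifted termwise bound: `|c_{m+1} e^{(2^{m+1}−1)t}| ≤ (210/4)·4^{−m} · e^{t}` on `t ≤ 0`. [folklore] -/
theorem term_succ_abs_le (m : ℕ) {t : ℝ} (ht : t ≤ 0) :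
    ‖(∏ i ∈ Finset.range (m + 1), ((-4 : ℝ) / (2 ^ (i + 1) - 1))) *
        Real.exp ((2 ^ (m + 1) - 1) * t)‖ ≤ 210 / 4 * (1 / 4) ^ m * Real.exp t := by
  rw [Real.norm_eq_abs, abs_mul, abs_of_pos (Real.exp_pos _)]
  have hexp : Real.exp ((2 ^ (m + 1) - 1) * t) ≤ Real.exp t := by
    refine Real.exp_le_exp.2 ?_
    have h2 : (2 : ℝ) ≤ 2 ^ (m + 1) := by
      calc (2 : ℝ) = 2 ^ 1 := (pow_one _).symm
        _ ≤ 2 ^ (m + 1) := pow_le_pow_right₀ (by norm_num) (by omega)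
    nlinarith
  have hc := coeff_abs_le (m + 1)
  have h4 : (210 : ℝ) / 4 ^ (m + 1) = 210 / 4 * (1 / 4) ^ m := by
    rw [pow_succ, one_div, inv_pow]; field_simp
  calc |∏ i ∈ Finset.range (m + 1), ((-4 : ℝ) / (2 ^ (i + 1) - 1))| * Real.exp ((2 ^ (m + 1) - 1) * t)
      ≤ 210 / 4 ^ (m + 1) * Real.exp t := mul_le_mul hc hexp (Real.exp_pos _).le (by positivity)
    _ = 210 / 4 * (1 / 4) ^ m * Real.exp t := by rw [h4]

/-- **`|w₁(t) − 1| ≤ 70 e^{t}` for `t ≤ 0`**: the adjoint mode is normalised by `w₁(−∞) = 1`, with an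
exponentially small correction. [folklore] -/
theorem adjoint_sub_one_abs_le {t : ℝ} (ht : t ≤ 0) :
    |(∑' m : ℕ, (∏ i ∈ Finset.range m, ((-4 : ℝ) / (2 ^ (i + 1) - 1))) *
        Real.exp ((2 ^ m - 1) * t)) - 1| ≤ 70 * Real.exp t := by
  rw [(adjoint_summable ht).tsum_eq_zero_add, term_zero, add_sub_cancel_left]
  have hg : Summable (fun m : ℕ => 210 / 4 * (1 / 4 : ℝ) ^ m * Real.exp t) :=
    ((summable_geometric_of_lt_one (by norm_num) (by norm_num)).mul_left (210 / 4)).mul_right _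
  have hle := fun m => term_succ_abs_le m ht
  calc |∑' m : ℕ, (∏ i ∈ Finset.range (m + 1), ((-4 : ℝ) / (2 ^ (i + 1) - 1))) *
          Real.exp ((2 ^ (m + 1) - 1) * t)|
      ≤ ∑' m : ℕ, 210 / 4 * (1 / 4 : ℝ) ^ m * Real.exp t := by
        rw [← Real.norm_eq_abs]
        exact tsum_of_norm_bounded hg.hasSum hle
    _ = 210 / 4 * (∑' m : ℕ, (1 / 4 : ℝ) ^ m) * Real.exp t := by
        rw [tsum_mul_right, tsum_mul_left]
    _ = 70 * Real.exp t := by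
        rw [tsum_geometric_of_lt_one (by norm_num) (by norm_num)]
        norm_num

/-- **`w₁(t) → 1` as `t → −∞`.** [folklore] -/
theorem adjoint_tendsto_atBot :
    Tendsto (fun t : ℝ => ∑' m : ℕ, (∏ i ∈ Finset.range m, ((-4 : ℝ) / (2 ^ (i + 1) - 1))) *
        Real.exp ((2 ^ m - 1) * t)) atBot (𝓝 1) := by
  have h70 : Tendsto (fun t : ℝ => 70 * Real.exp t) atBot (𝓝 0) := by
    simpa using Real.tendsto_exp_atBot.const_mul 70
  rw [tendsto_iff_norm_sub_tendsto_zero]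
  refine squeeze_zero_norm' ?_ h70
  filter_upwards [eventually_le_atBot (0 : ℝ)] with t ht
  rw [norm_norm, Real.norm_eq_abs]
  exact adjoint_sub_one_abs_le ht

end WakeRatchetRelayAdjoint

end Summit.NavierStokesRegularity.NavierStokesRegularity.Theorems

end
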